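import Mathlib
import HarnessLib

/-!
# NE7CoercivityGaugeTransfer — THE ALGEBRAIC CORE OF «COERCIVITY TRANSFERS ACROSS A GAUGE RE-PARAMETRISATION»: if a symmetric bilinear form `H` is `c`-coercive on a set
# `T_B` in a (semi)norm `Nm`, pairs every vector with GAUGE directions `g ∈ G` only tension-weakly (`|H(y,g)| ≤ τ·Nm y·Nm g`), and every element `t` of a second set `T_A`
# decomposes as `t = s + g` with `s ∈ T_B`, `g ∈ G`, `Nm g ≤ κ·Nm t` (`κ ≤ 1`), then `H` is `(c(1−κ)² − τκ(2+3κ))`-coercive on `T_A` — the step «row NE3's slice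
# `frameFreeBlockLandauW` ⟶ the [B8] (1.38) slice `ker Qbar ∩ IsLandauB8`» of memo §10, and the template for its cross terms (file 136 of the curved (APE), F207)

Cell `pub-balaban`, rung (B)+1 sub-cell t4, lineage `b2b-balaban-t4-ne7-p1` (CRUX PROVER NE7 #1 = OWNER of row NE7), generation 85; memo
`t4/b2b-balaban-t4-ne7-p1-g85/LAGRANGE-CARRIER.md` §10.  Mathlib only.
WHY.  The positivity letter (P_a) of the END F204 needs the tangent coercivity of the Wilson Hessian on OUR slice `T_A = ker QbarIter_W ∩ IsLandauB8` (print's `R(U)`-gauge),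
while row NE3 proves it (`classSlicePoincare_of_lines` + `weightedTangentCoercive_of_slicePoincare`) on ITS slice `T_B = frameFreeBlockLandauW` (plain block-Landau, frame-free).
The two slices are transversals of the same gauge orbit inside `ker QbarIter_W`: `t_A = t_B + D_Wν`, and the Hessian pairs anything with a pure gauge `D_Wν` through FIRST-VARIATION
(tension) terms only (`NE7HessGaugeDir.hess_gaugeDir_eq`, `NE7HessGaugeDirLeftGeneral.hess_gaugeDir_left`).  THIS file is the three-line algebra of that transfer, abstractly, so the
successor only has to supply the decomposition with its size `κ` (frame letter + Landau-correction letters, ℓ²) and the tension constant `τ`.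
WHAT ([folklore]; 0 def, 0 sorry; Mathlib only).  `form_add_add` (expansion of `H(s+g, s+g)`), **`coercive_transfer`** (the statement of the title), `coercive_transfer_pos` (the
constant is positive when `c(1−κ)² > τκ(2+3κ)`).
HONEST FRAMING (page 1): elementary algebra of a bilinear form; NO estimate of Bałaban's; nothing about the tree's operators is instantiated here; (P_a) NOT proved; (KL-B) at curved
`W` NOT proved; (APE) on curved data NOT proved; NOT ONE-STEP, NOT NE7; spine 0∕9; finite T⁴ rung (B)+1 — NOT infinite volume, NOT mass gap, NOT `BetaPertH`, NOT Clay.  Continuum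
YM on T⁴ ⇐ BetaPertH ∧ nine spine estimates (0/9 proved); BetaPertH ⇐ (D1) ∧ (D4) ∧ CAP+tail; G-an2-4 gates asym, D1 and NE2/3/4.
-/

set_option autoImplicit false

namespace Summit.QuantumFields.BalabanUV.T4Continuum.NE7CoercivityGaugeTransfer

variable {V : Type*} [AddCommGroup V] [Module ℝ V]

/-- Expansion of a symmetric bilinear form on a sum. [folklore] -/
theorem form_add_add (H : V →ₗ[ℝ] V →ₗ[ℝ] ℝ) (hsymm : ∀ u v : V, H u v = H v u) (s g : V) :
    H (s + g) (s + g) = H s s + 2 * H s g + H g g := by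
  simp only [map_add, LinearMap.add_apply, hsymm g s]
  ring

/-- **COERCIVITY TRANSFERS ACROSS A GAUGE RE-PARAMETRISATION.**  `H` symmetric bilinear; `Nm ≥ 0` subadditive and even; `H` is `c`-coercive on `T_B` (`c·Nm t² ≤ H t t`); gauge
directions pair tension-weakly (`|H y g| ≤ τ·Nm y·Nm g` for `g ∈ G`); every `t ∈ T_A` is `s + g` with `s ∈ T_B`, `g ∈ G`, `Nm g ≤ κ·Nm t`, `0 ≤ κ ≤ 1`.  THEN
`(c(1−κ)² − τκ(2+3κ))·Nm t² ≤ H t t` on `T_A`. [folklore] -/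
theorem coercive_transfer (H : V →ₗ[ℝ] V →ₗ[ℝ] ℝ) (hsymm : ∀ u v : V, H u v = H v u)
    (Nm : V → ℝ) (hN0 : ∀ v, 0 ≤ Nm v) (hNadd : ∀ u v, Nm (u + v) ≤ Nm u + Nm v) (hNneg : ∀ v, Nm (-v) = Nm v)
    {TA TB G : Set V} {c τ κ : ℝ} (hc : 0 ≤ c) (hτ : 0 ≤ τ) (hκ : 0 ≤ κ) (hκ1 : κ ≤ 1)
    (hcoer : ∀ t ∈ TB, c * Nm t ^ 2 ≤ H t t)
    (hten : ∀ y : V, ∀ g ∈ G, |H y g| ≤ τ * Nm y * Nm g)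
    (hdec : ∀ t ∈ TA, ∃ s ∈ TB, ∃ g ∈ G, t = s + g ∧ Nm g ≤ κ * Nm t) :
    ∀ t ∈ TA, (c * (1 - κ) ^ 2 - τ * κ * (2 + 3 * κ)) * Nm t ^ 2 ≤ H t t := by
  intro t ht
  obtain ⟨s, hs, g, hg, rfl, hgκ⟩ := hdec t ht
  set nt := Nm (s + g) with hnt
  have hnt0 : 0 ≤ nt := hN0 _
  have hg0 : 0 ≤ Nm g := hN0 g
  -- sizes of `s`: below and above
  have hs_le : Nm s ≤ nt + Nm g := by
    have h := hNadd (s + g) (-g)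
    rw [add_neg_cancel_right, hNneg] at h
    exact h
  have hs_ge : nt - Nm g ≤ Nm s := by linarith [hNadd s g]
  have hs_le' : Nm s ≤ (1 + κ) * nt := by nlinarith
  have hs_ge' : (1 - κ) * nt ≤ Nm s := by nlinarith
  have hs0 : 0 ≤ Nm s := hN0 s
  -- the three terms
  rw [form_add_add H hsymm s g]
  have h1 : c * ((1 - κ) * nt) ^ 2 ≤ H s s := by
    have hmono : ((1 - κ) * nt) ^ 2 ≤ Nm s ^ 2 := by
      have h0 : 0 ≤ (1 - κ) * nt := mul_nonneg (by linarith) hnt0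
      exact pow_le_pow_left₀ h0 hs_ge' 2
    exact (mul_le_mul_of_nonneg_left hmono hc).trans (hcoer s hs)
  have h2 : |H s g| ≤ τ * ((1 + κ) * nt) * (κ * nt) := by
    calc |H s g| ≤ τ * Nm s * Nm g := hten s g hg
      _ ≤ τ * ((1 + κ) * nt) * (κ * nt) := by gcongr
  have h3 : |H g g| ≤ τ * (κ * nt) * (κ * nt) := by
    calc |H g g| ≤ τ * Nm g * Nm g := hten g g hg
      _ ≤ τ * (κ * nt) * (κ * nt) := by gcongr
  have h2' := (abs_le.mp h2).1
  have h3' := (abs_le.mp h3).1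
  nlinarith [h1, h2', h3']

/-- The transferred constant is positive as soon as `τκ(2+3κ) < c(1−κ)²` (e.g. `κ ≤ 1∕2`, `5τκ < c∕4`). [folklore] -/
theorem coercive_transfer_pos {c τ κ : ℝ} (h : τ * κ * (2 + 3 * κ) < c * (1 - κ) ^ 2) :
    0 < c * (1 - κ) ^ 2 - τ * κ * (2 + 3 * κ) := by linarith

end Summit.QuantumFields.BalabanUV.T4Continuum.NE7CoercivityGaugeTransfer
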